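import Summits.ResolutionOfSingularities.ResolutionOfSingularities.Theorems.FrobeniusLadderFInjectiveMacaulayficationFHalfRowOfWeaklyNondegenerateMonomialFloor
import Summits.ResolutionOfSingularities.ResolutionOfSingularities.Theorems.FrobeniusLadderFInjectiveMacaulayficationFHalfRowOfToricCoverData
import HarnessLib

/-!
# (W-WND) Q12 (E): THE WEAK CLASS ROW ON F-108-SHAPED COVER DATA — point floor AND monomial floor (the RETRO-FIT socket of R21.12 (3)(ii) / R21.13 (3))
# (crux `FInjectiveMacaulayfication` stmt-ResolutionOfSingularities-15315, chain w45a; seat res-L1-w45a-stub-3 g11; twins-by-callee-swap of res-L1-w45a-stub-1's ✓ p655852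
# `FHalfRowOfToricCoverData.fHalfRow_of_toricCoverData` over (B′) `fHalfRow_of_weaklyNondegenerate` and (D) `fHalfRow_monomialFloor_of_weaklyNondegenerate`)

[OURS · L1 W4.5a] Support file (`--supports stmt-ResolutionOfSingularities-15315 --as helper`); def-free; UNCONDITIONAL (cover data explicit); no named fact; NOT a statement of any
manuscript. Nothing of the crux is proved. AI-written (AI review weaker than expert review).

* §1 sum-form translations (ns `FHalfRowOfToricCoverData`): `span_image_sum_eq_mul` (`(x^{t+b} : t ∈ T, b ∈ B) = (x^t)·(x^b)` in any `k[X]/F`), `hprim_of_sum`, `hAJ_of_sum`;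
* §2 ★★★ `fHalfRow_of_toricCoverData_weak` — ✓ p655852 §2 VERBATIM with `hND` ↦ `hWND : ∀ w > 0, IsWeaklyNondegenerateAlong w ↑f` (covers BED W and every (4,2)/(5,2) census
  bed, ✓ p656259): POINT-floor row from F-108-currency data (`B`, `A = {e_i + b}`, `vtx`, unimodular `V`, `VertexMinimises`, `ChartPresented`, `CommonMinimiser`, `CoverRecord`);
* §3 ★★★ `fHalfRow_monomialFloor_of_toricCoverData_weak` — the same at a MONOMIAL floor `I_T = (x^t : t ∈ T)` (`T ∋` a pure power of every variable, `0 ∉ T`), cover data for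
  `A = {t + b : t ∈ T, b ∈ B}` (so `I_A = I_T·K`): for EVERY blowing up of `Spec 𝒪_{X,v}` along `Ĩ_T` some `𝓚 ≠ ⊥` over the closed point cures it (all blowings up FULL at every
  stalk). RETRO-FIT usage (rows #1–#3, τ-floors; rows #4–#5, BED W/T, point floors): res-L1-w45a-stub-2 supplies `(B, t, vtx, V, presentations, minimisers, records)` for a
  Σ_f-refining unimodular cover of `Bl_{τ·K}` resp. `Bl_{𝔪·K}`; the row is then ONE `exact` of §3 resp. §2 with the bed's `prime_f` / `mk_X_ne_zero` / `regular_off_vertex` and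
  `CensusBedsWeaklyNondegenerate.weaklyNondegenerate_bed42 …`.
[cite: IshiiSingularities2018, Thm. 4.4.23, Lemma 4.4.24, Cor. 4.4.25 (pp. 95–97)] [cite: StacksProject, Tag 0804 and Tag 080A]
-/

-- single-problem summit: the doubled namespace component is forced
set_option linter.dupNamespace false

noncomputable section

open AlgebraicGeometry CategoryTheory Literature.AlgebraicGeometry.Resolution Literature.AlgebraicGeometry.Resolution.BoubakriGreuelMarkwig
  TopologicalSpace IsLocalRing MvPolynomial

namespace Summit.ResolutionOfSingularities.ResolutionOfSingularities.Theorems.FInjectiveMacaulayfication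

namespace FHalfRowOfToricCoverData

open Summit.ResolutionOfSingularities.ResolutionOfSingularities.Theorems.FInjectiveMacaulayfication
open SliceableCentre

variable {k : Type} [Field k] {n : ℕ}

/-! ## §1 Sum-form translations -/

/-- **Sum form**: in any quotient `R = k[X]/F`, the monomials `x^{t + b}` (`t ∈ T`, `b ∈ B`) span `(x^t : t ∈ T) · (x^b : b ∈ B)`. [folklore] -/
theorem span_image_sum_eq_mul (F : Ideal (MvPolynomial (Fin n) k)) (T B A : Finset (Fin n →₀ ℕ))
    (hA : A = (T ×ˢ B).image (fun q : (Fin n →₀ ℕ) × (Fin n →₀ ℕ) => q.1 + q.2)) :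
    Ideal.span ((fun e : Fin n →₀ ℕ => Ideal.Quotient.mk F (monomial e (1 : k))) '' (A : Set (Fin n →₀ ℕ))) =
      Ideal.span ((fun e : Fin n →₀ ℕ => Ideal.Quotient.mk F (monomial e (1 : k))) '' (T : Set (Fin n →₀ ℕ))) *
        Ideal.span ((fun e : Fin n →₀ ℕ => Ideal.Quotient.mk F (monomial e (1 : k))) '' (B : Set (Fin n →₀ ℕ))) := by
  classical
  have hmono : ∀ (t b : Fin n →₀ ℕ), Ideal.Quotient.mk F (monomial (t + b) (1 : k)) =
      Ideal.Quotient.mk F (monomial t (1 : k)) * Ideal.Quotient.mk F (monomial b (1 : k)) := by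
    intro t b
    rw [← map_mul, monomial_mul, one_mul]
  apply le_antisymm
  · rw [Ideal.span_le]
    rintro _ ⟨e, he, rfl⟩
    rw [hA, Finset.coe_image, Set.mem_image] at he
    obtain ⟨⟨t, b⟩, hq, rfl⟩ := he
    have htb := Finset.mem_product.mp (Finset.mem_coe.mp hq)
    show Ideal.Quotient.mk F (monomial (t + b) (1 : k)) ∈ _
    rw [hmono]
    exact Ideal.mul_mem_mul (Ideal.subset_span ⟨t, Finset.mem_coe.mpr htb.1, rfl⟩) (Ideal.subset_span ⟨b, Finset.mem_coe.mpr htb.2, rfl⟩)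
  · rw [Ideal.span_mul_span, Ideal.span_le]
    rintro _ ⟨_, ⟨t, ht, rfl⟩, _, ⟨b, hb, rfl⟩, rfl⟩
    show Ideal.Quotient.mk F (monomial t (1 : k)) * Ideal.Quotient.mk F (monomial b (1 : k)) ∈ _
    rw [← hmono]
    refine Ideal.subset_span ⟨t + b, ?_, rfl⟩
    rw [hA, Finset.coe_image]
    exact ⟨(t, b), Finset.mem_coe.mpr (Finset.mem_product.mpr ⟨ht, hb⟩), rfl⟩

/-- Sum form, pure powers: `x_j^{N+N'} = x^{N e_j + N' e_j} ∈ A`. [folklore] -/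
theorem hprim_of_sum (T B A : Finset (Fin n →₀ ℕ))
    (hA : A = (T ×ˢ B).image (fun q : (Fin n →₀ ℕ) × (Fin n →₀ ℕ) => q.1 + q.2))
    (hT : ∀ i : Fin n, ∃ N : ℕ, 0 < N ∧ Finsupp.single i N ∈ T) (hB : ∀ i : Fin n, ∃ N : ℕ, 0 < N ∧ Finsupp.single i N ∈ B) :
    ∀ j ∈ (Finset.univ : Finset (Fin n)), ∃ N : ℕ, Finsupp.single j N ∈ A := by
  classical
  intro j _
  obtain ⟨N, -, hN⟩ := hT j
  obtain ⟨N', -, hN'⟩ := hB j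
  refine ⟨N + N', ?_⟩
  rw [hA, Finset.mem_image]
  exact ⟨(Finsupp.single j N, Finsupp.single j N'), Finset.mem_product.mpr ⟨hN, hN'⟩, by rw [Finsupp.single_add]⟩

/-- Sum form: every generator `t + b` with `t ≠ 0` involves some variable. [folklore] -/
theorem hAJ_of_sum (T B A : Finset (Fin n →₀ ℕ))
    (hA : A = (T ×ˢ B).image (fun q : (Fin n →₀ ℕ) × (Fin n →₀ ℕ) => q.1 + q.2)) (hT0 : ∀ e ∈ T, e ≠ 0) :
    ∀ a ∈ A, ∃ j ∈ (Finset.univ : Finset (Fin n)), 0 < a j := by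
  classical
  intro a ha
  rw [hA, Finset.mem_image] at ha
  obtain ⟨⟨t, b⟩, hq, rfl⟩ := ha
  have ht : t ≠ 0 := hT0 t (Finset.mem_product.mp hq).1
  obtain ⟨j, hj⟩ : ∃ j, t j ≠ 0 := by
    by_contra hcon
    push Not at hcon
    exact ht (Finsupp.ext fun j => by simpa using hcon j)
  exact ⟨j, Finset.mem_univ j, by simp only [Finsupp.add_apply]; omega⟩

/-! ## §2 ★★★ Point floor, weak hypothesis -/

/-- ★★★ **THE CLASS ROW ON F-108-SHAPED COVER DATA, TJURINA VERSION (point floor).** p655852 §2 VERBATIM with Newton non-degeneracy weakened to WEAK non-degeneracy along every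
positive weight (`hWND`); one application of `FHalfRowOfNewtonNondegenerate.fHalfRow_of_weaklyNondegenerate`. [OURS; cite: IshiiSingularities2018, Thm. 4.4.23 and Cor. 4.4.25] -/
theorem fHalfRow_of_toricCoverData_weak (p : ℕ) [Fact p.Prime] (k : Type) [Field k] [IsAlgClosed k] [CharP k p] {n : ℕ} (hn : 0 < n)
    (f : MvPolynomial (Fin n) k) (hfp : Prime f)
    (hWND : ∀ w : Fin n → ℝ, (∀ i, 0 < w i) → IsWeaklyNondegenerateAlong w (f : MvPowerSeries (Fin n) k))
    (hXne : ∀ v : Fin n, Ideal.Quotient.mk (Ideal.span {f}) (X v) ≠ 0)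
    (hreg : ∀ x : Spec (.of (MvPolynomial (Fin n) k ⧸ Ideal.span {f})),
      ¬ Ideal.span (Set.range fun j : Fin n => Ideal.Quotient.mk (Ideal.span {f}) (X j)) ≤ x.asIdeal → IsRegularLocalRing (Localization.AtPrime x.asIdeal))
    (B : Finset (Fin n →₀ ℕ)) (hB : ∀ i : Fin n, ∃ N : ℕ, 0 < N ∧ Finsupp.single i N ∈ B)
    (A : Finset (Fin n →₀ ℕ)) (hA : A = (Finset.univ ×ˢ B).image (fun q : Fin n × (Fin n →₀ ℕ) => Finsupp.single q.1 1 + q.2))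
    (t : ℕ) (vtx : Fin t → (Fin n →₀ ℕ)) (V : Fin t → Matrix (Fin n) (Fin n) ℕ)
    (hvA : ∀ c, vtx c ∈ A) (hV : ∀ c, IsUnit ((V c).map (Nat.cast : ℕ → ℤ)).det)
    (hge : ∀ (c : Fin t), ∀ e ∈ A, (Finsupp.equivFunOnFinite.symm ((V c).mulVec ⇑(vtx c)) : Fin n →₀ ℕ) ≤ Finsupp.equivFunOnFinite.symm ((V c).mulVec ⇑e))
    (hpres : ∀ c : Fin t, ∃ a : Fin n → (Fin n →₀ ℕ), (∀ i, a i ∈ A) ∧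
      ∀ i, (Finsupp.equivFunOnFinite.symm ((V c).mulVec ⇑(a i)) : Fin n →₀ ℕ) = Finsupp.equivFunOnFinite.symm ((V c).mulVec ⇑(vtx c)) + Finsupp.single i 1)
    (hmin : ∀ c : Fin t, ∃ u₀ : Fin n →₀ ℕ, u₀ ∈ f.support ∧ ∀ i : Fin n, ∀ u ∈ f.support, ∑ j, V c i j * u₀ j ≤ ∑ j, V c i j * u j)
    (hrec : ∀ a ∈ A, ∃ (c : Fin t) (K : ℕ) (nn : (Fin n →₀ ℕ) → ℕ) (r : Fin n →₀ ℕ),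
      1 ≤ K ∧ (∑ b ∈ A, nn b) = K - 1 ∧ K • a = vtx c + (∑ b ∈ A, nn b • b) + r)
    (v : Spec (.of (MvPolynomial (Fin n) k ⧸ Ideal.span {f})))
    (hvm : v.asIdeal = Ideal.span (Set.range fun j : Fin n => Ideal.Quotient.mk (Ideal.span {f}) (X j))) :
    ∀ (S' : Scheme.{0}) (gS : S' ⟶ Spec ((Spec (.of (MvPolynomial (Fin n) k ⧸ Ideal.span {f}))).presheaf.stalk v)),
      IsBlowup gS ((affineBlowup.idealSheaf (Ideal.span (Set.range fun j : Fin n => Ideal.Quotient.mk (Ideal.span {f}) (X j)))).comap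
        ((Spec (.of (MvPolynomial (Fin n) k ⧸ Ideal.span {f}))).fromSpecStalk v)) →
      ∃ 𝓚 : S'.IdealSheafData, 𝓚 ≠ ⊥ ∧
        (∀ s ∈ (𝓚.support : Set S'), gS.base s = closedPoint ((Spec (.of (MvPolynomial (Fin n) k ⧸ Ideal.span {f}))).presheaf.stalk v)) ∧
        ∀ (S'' : Scheme.{0}) (π : S'' ⟶ S'), IsBlowup π 𝓚 → ∀ s : S'', FullCl p (S''.presheaf.stalk s) := by
  classical
  -- chart presentations, refining strict transforms (choice)
  choose a haA hgen using hpres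
  choose u₀ hu₀ humin using hmin
  have hθg := fun c => NewtonChartLemma.exists_theta_eq_monomial_mul_of_commonMinimiser (V c) (hV c) f (u₀ c) (hu₀ c) (humin c)
  choose g hθ hg0 using hθg
  -- the cover inequality, primality data, the product identity, the vertices
  have hcov : ∀ a ∈ A, ∃ (c : Fin t) (K : ℕ), 1 ≤ K ∧ ∃ y ∈ (Ideal.span ((fun b : Fin n →₀ ℕ => (MvPolynomial.monomial b (1 : k) : MvPolynomial (Fin n) k)) '' (A : Set (Fin n →₀ ℕ)))) ^ (K - 1),
      (MvPolynomial.monomial a (1 : k) : MvPolynomial (Fin n) k) ^ K = MvPolynomial.monomial (vtx c) 1 * y := by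
    intro a' ha'
    obtain ⟨c, K, nn, r, hK, hsum, hrec'⟩ := hrec a' ha'
    exact ⟨c, K, hK, hcov_of_coverRecord A (vtx c) a' K nn r hsum hrec'⟩
  have hKprim : ∀ j : Fin n, ∃ N : ℕ, Finsupp.single j N ∈ B := fun j => by
    obtain ⟨N, -, hN⟩ := hB j
    exact ⟨N, hN⟩
  have hv : ∀ c : Fin t, Ideal.Quotient.mk (Ideal.span {f}) (monomial (vtx c) (1 : k)) ∈
      Ideal.span ((fun e : Fin n →₀ ℕ => Ideal.Quotient.mk (Ideal.span {f}) (monomial e (1 : k))) '' (A : Set (Fin n →₀ ℕ))) :=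
    fun c => Ideal.subset_span ⟨vtx c, Finset.mem_coe.mpr (hvA c), rfl⟩
  exact FHalfRowOfNewtonNondegenerate.fHalfRow_of_weaklyNondegenerate p k hn f hfp hWND hXne hreg A B (span_image_prod_eq_mul (Ideal.span {f}) B A hA)
    hKprim (hprim_of_product B A hA hB) (hAJ_of_product B A hA) t vtx hcov V hV a haA hgen hge g
    (fun c => Finsupp.equivFunOnFinite.symm ((V c).mulVec ⇑(u₀ c))) hθ hg0 hv v hvm


/-! ## §3 ★★★ Monomial floor, weak hypothesis -/

/-- ★★★ **THE CLASS ROW ON F-108-SHAPED COVER DATA AT A MONOMIAL FLOOR, TJURINA VERSION.** As §2 with the point floor replaced by `I_T = (x^t : t ∈ T)` (`T` with a pure power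
of every variable and `0 ∉ T`) and product data `A = {t + b : t ∈ T, b ∈ B}`; one application of `FHalfRowOfNewtonNondegenerate.fHalfRow_monomialFloor_of_weaklyNondegenerate`.
[OURS; cite: IshiiSingularities2018, Thm. 4.4.23 and Cor. 4.4.25; StacksProject, Tag 080A] -/
theorem fHalfRow_monomialFloor_of_toricCoverData_weak (p : ℕ) [Fact p.Prime] (k : Type) [Field k] [IsAlgClosed k] [CharP k p] {n : ℕ} (hn : 0 < n)
    (f : MvPolynomial (Fin n) k) (hfp : Prime f)
    (hWND : ∀ w : Fin n → ℝ, (∀ i, 0 < w i) → IsWeaklyNondegenerateAlong w (f : MvPowerSeries (Fin n) k))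
    (hXne : ∀ v : Fin n, Ideal.Quotient.mk (Ideal.span {f}) (X v) ≠ 0)
    (hreg : ∀ x : Spec (.of (MvPolynomial (Fin n) k ⧸ Ideal.span {f})),
      ¬ Ideal.span (Set.range fun j : Fin n => Ideal.Quotient.mk (Ideal.span {f}) (X j)) ≤ x.asIdeal → IsRegularLocalRing (Localization.AtPrime x.asIdeal))
    (T : Finset (Fin n →₀ ℕ)) (hT : ∀ i : Fin n, ∃ N : ℕ, 0 < N ∧ Finsupp.single i N ∈ T) (hT0 : ∀ e ∈ T, e ≠ 0)
    (B : Finset (Fin n →₀ ℕ)) (hB : ∀ i : Fin n, ∃ N : ℕ, 0 < N ∧ Finsupp.single i N ∈ B)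
    (A : Finset (Fin n →₀ ℕ)) (hA : A = (T ×ˢ B).image (fun q : (Fin n →₀ ℕ) × (Fin n →₀ ℕ) => q.1 + q.2))
    (t : ℕ) (vtx : Fin t → (Fin n →₀ ℕ)) (V : Fin t → Matrix (Fin n) (Fin n) ℕ)
    (hvA : ∀ c, vtx c ∈ A) (hV : ∀ c, IsUnit ((V c).map (Nat.cast : ℕ → ℤ)).det)
    (hge : ∀ (c : Fin t), ∀ e ∈ A, (Finsupp.equivFunOnFinite.symm ((V c).mulVec ⇑(vtx c)) : Fin n →₀ ℕ) ≤ Finsupp.equivFunOnFinite.symm ((V c).mulVec ⇑e))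
    (hpres : ∀ c : Fin t, ∃ a : Fin n → (Fin n →₀ ℕ), (∀ i, a i ∈ A) ∧
      ∀ i, (Finsupp.equivFunOnFinite.symm ((V c).mulVec ⇑(a i)) : Fin n →₀ ℕ) = Finsupp.equivFunOnFinite.symm ((V c).mulVec ⇑(vtx c)) + Finsupp.single i 1)
    (hmin : ∀ c : Fin t, ∃ u₀ : Fin n →₀ ℕ, u₀ ∈ f.support ∧ ∀ i : Fin n, ∀ u ∈ f.support, ∑ j, V c i j * u₀ j ≤ ∑ j, V c i j * u j)
    (hrec : ∀ a ∈ A, ∃ (c : Fin t) (K : ℕ) (nn : (Fin n →₀ ℕ) → ℕ) (r : Fin n →₀ ℕ),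
      1 ≤ K ∧ (∑ b ∈ A, nn b) = K - 1 ∧ K • a = vtx c + (∑ b ∈ A, nn b • b) + r)
    (v : Spec (.of (MvPolynomial (Fin n) k ⧸ Ideal.span {f})))
    (hvm : v.asIdeal = Ideal.span (Set.range fun j : Fin n => Ideal.Quotient.mk (Ideal.span {f}) (X j))) :
    ∀ (S' : Scheme.{0}) (gS : S' ⟶ Spec ((Spec (.of (MvPolynomial (Fin n) k ⧸ Ideal.span {f}))).presheaf.stalk v)),
      IsBlowup gS ((affineBlowup.idealSheaf (Ideal.span ((fun e : Fin n →₀ ℕ => Ideal.Quotient.mk (Ideal.span {f}) (monomial e (1 : k))) '' (T : Set (Fin n →₀ ℕ))))).comap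
        ((Spec (.of (MvPolynomial (Fin n) k ⧸ Ideal.span {f}))).fromSpecStalk v)) →
      ∃ 𝓚 : S'.IdealSheafData, 𝓚 ≠ ⊥ ∧
        (∀ s ∈ (𝓚.support : Set S'), gS.base s = closedPoint ((Spec (.of (MvPolynomial (Fin n) k ⧸ Ideal.span {f}))).presheaf.stalk v)) ∧
        ∀ (S'' : Scheme.{0}) (π : S'' ⟶ S'), IsBlowup π 𝓚 → ∀ s : S'', FullCl p (S''.presheaf.stalk s) := by
  classical
  -- chart presentations, refining strict transforms (choice)
  choose a haA hgen using hpres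
  choose u₀ hu₀ humin using hmin
  have hθg := fun c => NewtonChartLemma.exists_theta_eq_monomial_mul_of_commonMinimiser (V c) (hV c) f (u₀ c) (hu₀ c) (humin c)
  choose g hθ hg0 using hθg
  -- the cover inequality, primality data, the product identity, the vertices
  have hcov : ∀ a ∈ A, ∃ (c : Fin t) (K : ℕ), 1 ≤ K ∧ ∃ y ∈ (Ideal.span ((fun b : Fin n →₀ ℕ => (MvPolynomial.monomial b (1 : k) : MvPolynomial (Fin n) k)) '' (A : Set (Fin n →₀ ℕ)))) ^ (K - 1),
      (MvPolynomial.monomial a (1 : k) : MvPolynomial (Fin n) k) ^ K = MvPolynomial.monomial (vtx c) 1 * y := by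
    intro a' ha'
    obtain ⟨c, K, nn, r, hK, hsum, hrec'⟩ := hrec a' ha'
    exact ⟨c, K, hK, hcov_of_coverRecord A (vtx c) a' K nn r hsum hrec'⟩
  have hKprim : ∀ j : Fin n, ∃ N : ℕ, Finsupp.single j N ∈ B := fun j => by
    obtain ⟨N, -, hN⟩ := hB j
    exact ⟨N, hN⟩
  have hv : ∀ c : Fin t, Ideal.Quotient.mk (Ideal.span {f}) (monomial (vtx c) (1 : k)) ∈
      Ideal.span ((fun e : Fin n →₀ ℕ => Ideal.Quotient.mk (Ideal.span {f}) (monomial e (1 : k))) '' (A : Set (Fin n →₀ ℕ))) :=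
    fun c => Ideal.subset_span ⟨vtx c, Finset.mem_coe.mpr (hvA c), rfl⟩
  have hTne : T.Nonempty := by
    obtain ⟨N, -, hN⟩ := hT ⟨0, hn⟩
    exact ⟨_, hN⟩
  exact FHalfRowOfNewtonNondegenerate.fHalfRow_monomialFloor_of_weaklyNondegenerate p k hn f hfp hWND hXne hreg T A B hTne
    (span_image_sum_eq_mul (Ideal.span {f}) T B A hA) hKprim (hprim_of_sum T B A hA hT hB) (hAJ_of_sum T B A hA hT0) t vtx hcov V hV a haA hgen hge g
    (fun c => Finsupp.equivFunOnFinite.symm ((V c).mulVec ⇑(u₀ c))) hθ hg0 hv v hvm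


end FHalfRowOfToricCoverData

end Summit.ResolutionOfSingularities.ResolutionOfSingularities.Theorems.FInjectiveMacaulayfication

end
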